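import Mathlib
import Summits.Ventures.PercRepro2.Defs
import Summits.Ventures.PercRepro2.Graph
import Summits.Ventures.PercRepro2.OneColourSwitch
import Summits.Ventures.PercRepro2.RegionHubSign
import Summits.Ventures.PercRepro2.SideSwitch
import Summits.Ventures.PercRepro2.SideSwitchFibre
import Summits.Ventures.PercRepro2.SideSwitchComps
import Summits.Ventures.PercRepro2.M9NoPocketDefs
import Summits.Ventures.PercRepro2.M9NoPocketWorld
import Summits.Ventures.PercRepro2.M9NoPocketWorldD
import Summits.Ventures.PercRepro2.M9NoPocketLegal
import Summits.Ventures.PercRepro2.M9NoPocketCompl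
import Summits.Ventures.PercRepro2.M9NoPocketFreeBlock
import Summits.Ventures.PercRepro2.M9NoPocketFreeBlockK
import Summits.Ventures.PercRepro2.M9NoPocketSameType
import Summits.Ventures.PercRepro2.M9NoPocketDeadPattern
import Summits.Ventures.PercRepro2.M9NoPocketLinkCompl
import Summits.Ventures.PercRepro2.M9NoPocketSigmaRS

/-!
# The legal vectors of a dead pattern: `K`-points and `M`-points (blind cell PercRepro2, p3 g36,
2026-08-29; `proofs/P3-NPHDR.md` §5′, the dirty points)

For a dead pattern `∅ ≠ D ≠ A` of a same-type representative the legal vectors are exactly the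
`K`-points `(T, ∅)` (`T` free, every joined block on the `Y` side) and the `M`-points
`(T ∪ 𝔑, ∅)` (every joined block switched) (`mem_L4_flipF_iff`): a switched joined block with
a live edge is a `W`-source and forbids every dead edge towards an unswitched block, so all
joined blocks are switched; an unswitched joined block with a live edge is a `Y`-source and
forbids every dead edge towards a switched block.  Hence a sum over the legal vectors is the
sum over the `K`-points plus the sum over the `M`-points (`sum_L4_flipF_eq`), and the `M`-points
of `ρ₀` are, through the colour flip, the `K`-points of the outside flip `ρ₁` with the same sign
product (`sigma_mul_M_eq_K_flipOp`).  Own work; std axioms.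
-/

namespace Summit.Ventures.PercRepro2

namespace NoPocket

open Finset Classical RegionHub OneColourSwitch SideSwitch

variable {V : Type*} {E : Type*}

section DeadLegal

variable [Fintype V] [DecidableEq V] [Fintype E] [DecidableEq E] {ends : E → Sym2 V}

omit [Fintype V] [DecidableEq V] [Fintype E] in
/-- A joined block has a live edge or a dead edge in a dead pattern. -/
lemma joined_live_or_dead {d : V} {ρ₀ : Config E} (hst : ∀ e, d ∈ ends e → ρ₀ e = true)
    (D : Finset E) {C : Finset V} (hY : hasY ends d ρ₀ C) :
    hasY ends d (flipF D ρ₀) C ∨ hasW ends d (flipF D ρ₀) C := by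
  obtain ⟨e, y, hy, hends⟩ := (hasY_sameType_iff hst C).1 hY
  by_cases heD : e ∈ D
  · exact Or.inr ((hasW_flipF_iff hst D C).2 ⟨e, heD, y, hy, hends⟩)
  · exact Or.inl ((hasY_flipF_iff hst D C).2 ⟨e, heD, y, hy, hends⟩)

/-- **The legal vectors of a dead pattern `∅ ≠ D ≠ A`**: the `K`-points (free blocks only) and
the `M`-points (every joined block switched). -/
theorem mem_L4_flipF_iff {d r s : V} (hnp : NoPocketAt ends d r s) (hr : d ≠ r) (hs : d ≠ s)
    (hT : Tset ends d r s = ∅) (hloop : ∀ e, ends e ≠ s(d, d)) {ρ₀ : Config E}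
    (hst : ∀ e, d ∈ ends e → ρ₀ e = true) {D : Finset E}
    (hD : D ⊆ univ.filter (fun e => d ∈ ends e)) (hD0 : D ≠ ∅)
    (hDA : D ≠ univ.filter (fun e => d ∈ ends e)) {x : Finset (Finset V) × Finset E} :
    x ∈ L4 ends d r s (flipF D ρ₀) ↔
      x.2 = ∅ ∧ x.1 ⊆ blocks ends d r s ρ₀ ∧
        (x.1 ⊆ (blocks ends d r s ρ₀).filter (fun C => ¬ hasY ends d ρ₀ C) ∨
          (blocks ends d r s ρ₀).filter (hasY ends d ρ₀) ⊆ x.1) := by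
  have hDd : ∀ e ∈ D, d ∈ ends e := fun e he => (Finset.mem_filter.1 (hD he)).2
  have hb := blocks_flipF (ends := ends) (r := r) (s := s) (ρ := ρ₀) hDd
  constructor
  · intro hx
    obtain ⟨⟨hT1, hF⟩, hLW, hLY⟩ := mem_L4.1 hx
    rw [hT] at hF
    rw [hb] at hT1
    refine ⟨Finset.subset_empty.1 hF, hT1, ?_⟩
    by_cases hK : x.1 ⊆ (blocks ends d r s ρ₀).filter (fun C => ¬ hasY ends d ρ₀ C)
    · exact Or.inl hK
    right
    -- a switched joined block `C`
    obtain ⟨C, hCx, hCnf⟩ := Finset.not_subset.1 hK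
    have hCb : C ∈ blocks ends d r s ρ₀ := hT1 hCx
    have hCY : hasY ends d ρ₀ C := by
      by_contra h
      exact hCnf (Finset.mem_filter.2 ⟨hCb, h⟩)
    -- if `C` has a dead edge, `d` has no `Y`-source; if a live edge, `d` is a `W`-source
    -- and no unswitched block has a dead edge; either way every joined block is switched
    intro C' hC'
    obtain ⟨hC'b, hC'Y⟩ := Finset.mem_filter.1 hC'
    by_contra hC'x
    have hC'b' : C' ∈ blocks ends d r s (flipF D ρ₀) := by rw [hb]; exact hC'b
    rcases joined_live_or_dead hst D hCY with hCl | hCd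
    · -- `C` live and switched: `W`-source, so `C'` has no dead edge, hence a live edge,
      -- hence `d` has a `Y`-source, forbidding the switched `C` to be dead — but then every
      -- dead edge is impossible: `D = ∅`
      have hsrcW : srcW ends d r s (flipF D ρ₀) x := Or.inr ⟨C, hCx, hCl⟩
      have hnoW := hLW hsrcW
      rcases joined_live_or_dead hst D hC'Y with hC'l | hC'd
      · have hsrcY : srcY ends d r s (flipF D ρ₀) x := Or.inr ⟨C', hC'b', hC'x, hC'l⟩
        have hnoW' := hLY hsrcY
        -- no block has a dead edge: contradiction with `D ≠ ∅`
        obtain ⟨e, heD⟩ := Finset.nonempty_iff_ne_empty.2 hD0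
        obtain ⟨C'', hC'', y, hy, hends⟩ :=
          exists_block_of_edge_at_d hnp hr hs hT hloop ρ₀ (hDd e heD)
        have hW'' : hasW ends d (flipF D ρ₀) C'' := (hasW_flipF_iff hst D C'').2 ⟨e, heD, y, hy, hends⟩
        have hC''b : C'' ∈ blocks ends d r s (flipF D ρ₀) := by rw [hb]; exact hC''
        by_cases hC''x : C'' ∈ x.1
        · exact hnoW' C'' hC''x hW''
        · exact hnoW C'' hC''b hC''x hW''
      · exact hnoW C' hC'b' hC'x hC'd
    · -- `C` dead and switched: `d` has no `Y`-source, so the unswitched `C'` has no live edge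
      rcases joined_live_or_dead hst D hC'Y with hC'l | hC'd
      · have hsrcY : srcY ends d r s (flipF D ρ₀) x := Or.inr ⟨C', hC'b', hC'x, hC'l⟩
        exact hLY hsrcY C hCx hCd
      · -- both `C` (switched) and `C'` (unswitched) dead: no `Y`-source and no `W`-source
        -- is possible only if every joined block is dead, i.e. `D = A`
        exfalso
        obtain ⟨e, he, heD⟩ := Finset.exists_of_ssubset (Finset.ssubset_iff_subset_ne.2 ⟨hD, hDA⟩)
        obtain ⟨C₀, hC₀, y, hy, hends⟩ :=
          exists_block_of_edge_at_d hnp hr hs hT hloop ρ₀ (Finset.mem_filter.1 he).2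
        have hC₀l : hasY ends d (flipF D ρ₀) C₀ := (hasY_flipF_iff hst D C₀).2 ⟨e, heD, y, hy, hends⟩
        have hC₀b : C₀ ∈ blocks ends d r s (flipF D ρ₀) := by rw [hb]; exact hC₀
        by_cases hC₀x : C₀ ∈ x.1
        · exact hLW (Or.inr ⟨C₀, hC₀x, hC₀l⟩) C' hC'b' hC'x hC'd
        · exact hLY (Or.inr ⟨C₀, hC₀b, hC₀x, hC₀l⟩) C hCx hCd
  · rintro ⟨hx2, hx1, hK | hM⟩
    · exact (mem_L4_srcY_flipF_iff hnp hr hs hT hloop hst hD hD0 hDA).2 ⟨hK, hx2⟩ |>.1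
    · -- every joined block switched: `d` has no `Y`-source, and the `W`-source legality holds
      -- because the unswitched blocks are free
      rw [mem_L4]
      refine ⟨⟨by rw [hb]; exact hx1, by rw [hx2]; exact Finset.empty_subset _⟩, ?_, ?_⟩
      · intro _ C hCb hCx
        have hCb' : C ∈ blocks ends d r s ρ₀ := by rw [← hb]; exact hCb
        have hfree : Free ends d C := by
          refine (free_iff_not_hasY_sameType hst C).2 (fun hY => hCx (hM ?_))
          exact Finset.mem_filter.2 ⟨hCb', hY⟩
        exact not_hasW_flipF_of_free hst D hfree
      · intro hsrcY
        exfalso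
        rcases hsrcY with ⟨e, he, _⟩ | ⟨C, hCb, hCx, hY⟩
        · rw [hT] at he
          exact Finset.notMem_empty e he
        · obtain ⟨e, heD, y, hy, hends⟩ := (hasY_flipF_iff hst D C).1 hY
          have hCb' : C ∈ blocks ends d r s ρ₀ := by rw [← hb]; exact hCb
          exact hCx (hM (Finset.mem_filter.2 ⟨hCb', (hasY_sameType_iff hst C).2 ⟨e, y, hy, hends⟩⟩))

/-- **A sum over the legal vectors of a dead pattern `∅ ≠ D ≠ A`** is the sum over the
`K`-points plus the sum over the `M`-points. -/
theorem sum_L4_flipF_eq {d r s : V} (hnp : NoPocketAt ends d r s) (hr : d ≠ r) (hs : d ≠ s)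
    (hT : Tset ends d r s = ∅) (hloop : ∀ e, ends e ≠ s(d, d)) {ρ₀ : Config E}
    (hst : ∀ e, d ∈ ends e → ρ₀ e = true) {D : Finset E}
    (hD : D ⊆ univ.filter (fun e => d ∈ ends e)) (hD0 : D ≠ ∅)
    (hDA : D ≠ univ.filter (fun e => d ∈ ends e)) {𝔉 𝔑 : Finset (Finset V)}
    (h𝔉 : 𝔉 = (blocks ends d r s ρ₀).filter (fun C => ¬ hasY ends d ρ₀ C))
    (h𝔑 : 𝔑 = (blocks ends d r s ρ₀).filter (hasY ends d ρ₀)) (h𝔑0 : 𝔑 ≠ ∅)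
    (f : Finset (Finset V) × Finset E → ℤ) :
    ∑ x ∈ L4 ends d r s (flipF D ρ₀), f x =
      ∑ T ∈ 𝔉.powerset, f (T, ∅) + ∑ T ∈ 𝔉.powerset, f (T ∪ 𝔑, ∅) := by
  have hiff := fun x => mem_L4_flipF_iff hnp hr hs hT hloop hst hD hD0 hDA (x := x)
  rw [← Finset.sum_filter_add_sum_filter_not (L4 ends d r s (flipF D ρ₀)) (fun x => x.1 ⊆ 𝔉)]
  congr 1
  · refine Finset.sum_nbij' (fun x => x.1) (fun T => (T, ∅)) ?_ ?_ ?_ ?_ ?_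
    · intro x hx
      exact Finset.mem_powerset.2 (Finset.mem_filter.1 hx).2
    · intro T hTp
      have hTf := Finset.mem_powerset.1 hTp
      refine Finset.mem_filter.2 ⟨(hiff _).2 ⟨rfl, ?_, Or.inl ?_⟩, hTf⟩
      · show T ⊆ _
        rw [h𝔉] at hTf
        exact hTf.trans (Finset.filter_subset _ _)
      · show T ⊆ _
        rw [← h𝔉]; exact hTf
    · intro x hx
      have h2 := ((hiff x).1 (Finset.mem_filter.1 hx).1).1
      exact Prod.ext rfl h2.symm
    · intro T _
      rfl
    · intro x hx
      have h2 := ((hiff x).1 (Finset.mem_filter.1 hx).1).1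
      have : x = (x.1, ∅) := Prod.ext rfl h2
      rw [← this]
  · refine Finset.sum_nbij' (fun x => x.1 \ 𝔑) (fun T => (T ∪ 𝔑, ∅)) ?_ ?_ ?_ ?_ ?_
    · intro x hx
      obtain ⟨hxL, hxK⟩ := Finset.mem_filter.1 hx
      obtain ⟨_, hxb, hKM⟩ := (hiff x).1 hxL
      refine Finset.mem_powerset.2 (fun C hC => ?_)
      obtain ⟨hCx, hC𝔑⟩ := Finset.mem_sdiff.1 hC
      have hCb := hxb hCx
      rw [h𝔉]
      refine Finset.mem_filter.2 ⟨hCb, fun hY => hC𝔑 ?_⟩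
      rw [h𝔑]; exact Finset.mem_filter.2 ⟨hCb, hY⟩
    · intro T hTp
      have hTf := Finset.mem_powerset.1 hTp
      refine Finset.mem_filter.2 ⟨(hiff _).2 ⟨rfl, ?_, Or.inr ?_⟩, ?_⟩
      · show T ∪ 𝔑 ⊆ _
        rw [h𝔉] at hTf
        rw [h𝔑]
        exact Finset.union_subset (hTf.trans (Finset.filter_subset _ _)) (Finset.filter_subset _ _)
      · show _ ⊆ T ∪ 𝔑
        rw [← h𝔑]; exact Finset.subset_union_right
      · show ¬ (T ∪ 𝔑 ⊆ 𝔉)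
        intro h
        obtain ⟨C, hC⟩ := Finset.nonempty_iff_ne_empty.2 h𝔑0
        have hCf := h (Finset.mem_union_right _ hC)
        rw [h𝔉] at hCf
        rw [h𝔑] at hC
        exact (Finset.mem_filter.1 hCf).2 (Finset.mem_filter.1 hC).2
    · intro x hx
      obtain ⟨hxL, hxK⟩ := Finset.mem_filter.1 hx
      obtain ⟨hx2, _, hKM⟩ := (hiff x).1 hxL
      have hM : 𝔑 ⊆ x.1 := by
        rcases hKM with hK | hM
        · exact absurd (by rw [h𝔉]; exact hK) hxK
        · rw [h𝔑]; exact hM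
      refine Prod.ext ?_ hx2.symm
      show x.1 \ 𝔑 ∪ 𝔑 = x.1
      exact Finset.sdiff_union_of_subset hM
    · intro T hTp
      have hTf := Finset.mem_powerset.1 hTp
      show (T ∪ 𝔑) \ 𝔑 = T
      rw [Finset.union_sdiff_right, Finset.sdiff_eq_self_iff_disjoint]
      rw [Finset.disjoint_left]
      intro C hCT hC𝔑
      rw [h𝔉] at hTf
      rw [h𝔑] at hC𝔑
      exact (Finset.mem_filter.1 (hTf hCT)).2 (Finset.mem_filter.1 hC𝔑).2
    · intro x hx
      obtain ⟨hxL, hxK⟩ := Finset.mem_filter.1 hx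
      obtain ⟨hx2, _, hKM⟩ := (hiff x).1 hxL
      have hM : 𝔑 ⊆ x.1 := by
        rcases hKM with hK | hM
        · exact absurd (by rw [h𝔉]; exact hK) hxK
        · rw [h𝔑]; exact hM
      have : x = (x.1 \ 𝔑 ∪ 𝔑, ∅) := Prod.ext (Finset.sdiff_union_of_subset hM).symm hx2
      rw [← this]

/-- **An `M`-point of a dead pattern is, through the colour flip, a `K`-point of the outside
flip, with the same sign product.** -/
theorem sigma_mul_M_eq_K_flipOp {p q r s d : V} (hnp : NoPocketAt ends d r s) (hr : d ≠ r)
    (hs : d ≠ s) (hT : Tset ends d r s = ∅) (hrs : ∀ e, ends e ≠ s(r, s)) {ρ₀ : Config E}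
    (hρ₀ : ρ₀ ∈ RepD ends p q r s d) {D : Finset E} (hD : ∀ e ∈ D, d ∈ ends e)
    {𝔉 𝔑 : Finset (Finset V)}
    (h𝔉 : 𝔉 = (blocks ends d r s ρ₀).filter (fun C => ¬ hasY ends d ρ₀ C))
    (h𝔑 : 𝔑 = (blocks ends d r s ρ₀).filter (hasY ends d ρ₀)) {T : Finset (Finset V)}
    (hTf : T ⊆ 𝔉) :
    sigma ends (assignX ends (T ∪ 𝔑, ∅) (flipF D ρ₀)) p q *
        sigma ends (assignX ends (T ∪ 𝔑, ∅) (flipF D ρ₀)) r s =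
      sigma ends (assignX ends (𝔉 \ T, ∅) (flipF D (flipOp ends d r s ρ₀))) p q *
        sigma ends (assignX ends (𝔉 \ T, ∅) (flipF D (flipOp ends d r s ρ₀))) r s := by
  have hρD := flipF_mem_RepD hρ₀ hT hD
  have hb := blocks_flipF (ends := ends) (r := r) (s := s) (ρ := ρ₀) hD
  have hTf' : T ⊆ (blocks ends d r s ρ₀).filter (fun C => ¬ hasY ends d ρ₀ C) := by
    rw [← h𝔉]; exact hTf
  have hX : T ∪ 𝔑 ⊆ blocks ends d r s (flipF D ρ₀) := by
    rw [hb, h𝔑]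
    exact Finset.union_subset (hTf'.trans (Finset.filter_subset _ _)) (Finset.filter_subset _ _)
  have hsd : blocks ends d r s (flipF D ρ₀) \ (T ∪ 𝔑) = 𝔉 \ T := by
    rw [hb]
    have := blocks_sdiff_union ρ₀ hTf' (S := (blocks ends d r s ρ₀).filter (hasY ends d ρ₀))
      (Finset.Subset.refl _)
    rw [Finset.sdiff_self, Finset.union_empty, ← h𝔉, ← h𝔑] at this
    exact this
  rw [sigma_assignX_eq_neg_dual hnp hr hs hT hrs hρD hX p q,
    sigma_assignX_eq_neg_dual hnp hr hs hT hrs hρD hX r s, hsd, ← flipOp_flipF ρ₀ hD]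
  ring

end DeadLegal

end NoPocket

end Summit.Ventures.PercRepro2
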